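import Literature.Topology.FourManifolds.SPC4HandlesThmAPositiveGenus
import HarnessLib

/-!
# Laudenbach–Poénaru's extension theorem decomposed: Lemma 2 (realisation), Cerf's `Γ₄ = 0`,
# and Theorem A in positive genus

Topic `Topology/FourManifolds`; namespace `Literature.Topology.FourManifolds`. Fact-decomposition
file (librarian 2026-08-16) for the named fact
`Literature.Topology.FourManifolds.exists_diffeomorph_comp_incl_eq` (**spc4.S24 (c)**,
`SPC4Handles.lean`: every self-diffeomorphism of the boundary `#k S¹ × S²` of a compact connected
orientable smooth `4`-dimensional `1`-handlebody `V ≅ ♮k S¹ × B³` extends over `V`;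
F. Laudenbach, V. Poénaru, *A note on 4-dimensional handlebodies*, Bull. SMF 100 (1972), Thm. A and
its proof, §2, pp. 339–342).

State of the tree (`SPC4HandlesThmAPositiveGenus.lean`,
`exists_diffeomorph_comp_incl_eq_zero_iff_cerf_and_succ_of_realise`). Granted the realisation of
the generators of `Aut F_p` on one model handlebody per `p` (REALISE, Lemma 2, pp. 339–340; the
named fact `exists_oneHandlebody_realise_laudenbachPoenaruGenerators`), the fact in universe `0`
is EQUIVALENT to the conjunction of Cerf's `Γ₄ = 0` in extension form (the named fact
`cerf_diffeomorph_sphere_three_extends_ball`; it is the case `p = 0`, `V = D⁴`, of the fact) and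
the positive-genus slice of Theorem A on the models (p. 342: Lemma 3 — a `π₁`-trivial
orientation-preserving diffeomorphism of `#p S¹ × S²` is `π₂`-trivial — then Laudenbach's isotopy
theorem for homotopic systems of `2`-spheres, Ann. of Math. 97 (1973), §5, then extension over the
handles), which entered the tree only as a plain binder (`hpos`).

This file NAMES that slice (the explicit exception of 2026-08-16 to D-0027 A7 for budget-capped
facts) and records the assembly:

* `laudenbachPoenaru_thmA_model_succ` — **named fact** (Laudenbach–Poénaru 1972, Thm. A for
  `p ≥ 1` on one model per `p`): for every `p` there is a compact connected orientable smooth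
  `4`-manifold with boundary with one `0`-handle and `p + 1` `1`-handles, a boundary datum `b₀` and
  a base point `z₀ ∈ b₀.carrier`, such that every orientation-preserving self-diffeomorphism of
  `b₀.carrier` fixing `z₀` and inducing the identity of `π₁(b₀.carrier, z₀)` extends over the
  handlebody — verbatim the binder `hpos` of `SPC4HandlesThmAPositiveGenus.lean`;
* `exists_diffeomorph_comp_incl_eq_holds_of` — **the assembly, PROVED**: REALISE, `Γ₄ = 0` and the
  slice imply the fact in every universe (`exists_diffeomorph_comp_incl_eq_of_realise_of_cerf_of_succ`).

So the children of the fact are exactly: `exists_oneHandlebody_realise_laudenbachPoenaruGenerators`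
(existing), `cerf_diffeomorph_sphere_three_extends_ball` (existing, itself reduced in the tree to
Cerf's `π₀(Diff(D³ rel S²)) = 0`, `CerfPropositionFour.lean`) and `laudenbachPoenaru_thmA_model_succ`
(new). Conversely the fact contains the slice (`thmA_succ_of_exists_diffeomorph_comp_incl_eq_zero`)
and Cerf's theorem (`SPC4HandlesImpliesCerf.lean`), so nothing stronger than the fact is named.

## References

* F. Laudenbach, V. Poénaru, *A note on 4-dimensional handlebodies*, Bull. Soc. Math. France 100
  (1972), 337–344: §2, Lemma 2 (pp. 339–340), Lemma 3 (p. 340), proof of Thm. A (pp. 341–342).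
  [LaudenbachPoenaruBSMF1972]
* F. Laudenbach, *Sur les 2-sphères d'une variété de dimension 3*, Ann. of Math. 97 (1973),
  57–81, §5. [Laudenbach1973]
* J. Cerf, *Sur les difféomorphismes de la sphère de dimension trois (Γ₄ = 0)*, LNM 53 (1968),
  Ch. I §1, Théorème 1, Corollaire 1. [CerfDiffeoSphere1968]

## Design notes

* The slice is stated at `p + 1` and in universe `0`, the universe in which it is consumed by
  `exists_diffeomorph_comp_incl_eq_of_realise_of_cerf_of_succ`; no notation is introduced.
-/

open scoped Manifold ContDiff Topology
open Set Function Metric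

noncomputable section

namespace Literature.Topology.FourManifolds

universe u

/-- **Laudenbach–Poénaru 1972, Theorem A in positive genus, on one model per `p`** (Bull. SMF 100,
proof of Thm. A, p. 342: for `p ≥ 1`, an orientation-preserving self-diffeomorphism `h` of
`∂Y_p = #p S¹ × S²` inducing the identity on `π₁` is `π₂`-trivial by Lemma 3 (p. 340), hence by
Laudenbach (1973), §5, isotopic to one preserving the system of spheres `⋃ xᵢ × S²`, and then extends
over the `0`-handle — by `Γ₄ = 0` — and over the `1`-handles). Statement (the binder `hpos` of
`SPC4HandlesThmAPositiveGenus.lean`, verbatim): for every `p` there are a compact connected smooth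
`4`-manifold with boundary `V₀ : Type` with a handle decomposition with one `0`-handle and `p + 1`
`1`-handles, orientable, a boundary datum `b₀` and a base point `z₀ ∈ b₀.carrier`, such that every
orientation-preserving `ψ : b₀.carrier ≃ b₀.carrier` with `ψ z₀ = z₀` acting as the identity on
`π₁(b₀.carrier, z₀)` extends to a self-diffeomorphism of `V₀` (`b₀.DiffeoExtends ψ`). Named fact
(statement only); with REALISE and Cerf's `Γ₄ = 0` it is equivalent to
`exists_diffeomorph_comp_incl_eq.{0}`. [cite: LaudenbachPoenaruBSMF1972, §2, Lemma 3 (p. 340) and proof of Thm. A (p. 342)]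
[cite: Laudenbach1973, §5] -/
def laudenbachPoenaru_thmA_model_succ : Prop :=
  ∀ p : ℕ, ∃ (V₀ : Type) (_ : TopologicalSpace V₀) (_ : T2Space V₀)
    (_ : SecondCountableTopology V₀) (_ : CompactSpace V₀) (_ : ConnectedSpace V₀)
    (_ : ChartedSpace (EuclideanHalfSpace 4) V₀) (_ : IsManifold (𝓡∂ 4) ∞ V₀)
    (b₀ : BoundaryData (𝓡∂ 4) V₀ (𝓡 3)) (z₀ : b₀.carrier),
    HasHandleDecomposition 3 V₀ (handleCount 1 (p + 1)) ∧ IsOrientable (𝓡∂ 4) V₀ ∧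
    ∀ (ψ : b₀.carrier ≃ₘ⟮𝓡 3, 𝓡 3⟯ b₀.carrier),
      (∀ o : SmoothOrientation (𝓡 3) b₀.carrier, ψ.IsOrientationPreserving o o) →
      ∀ hz : ψ z₀ = z₀,
        (∀ a : FundamentalGroup b₀.carrier z₀,
          FundamentalGroup.mapOfEq (⟨ψ, ψ.continuous⟩ : C(b₀.carrier, b₀.carrier)) hz a = a) →
        b₀.DiffeoExtends ψ

/-- **`exists_diffeomorph_comp_incl_eq` (spc4.S24 (c)) from its three children**: the
realisation of Laudenbach–Poénaru's generators on one model per `p`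
(`exists_oneHandlebody_realise_laudenbachPoenaruGenerators`, Lemma 2, pp. 339–340), Cerf's
`Γ₄ = 0` in extension form (`cerf_diffeomorph_sphere_three_extends_ball`) and Theorem A in positive
genus (`laudenbachPoenaru_thmA_model_succ`) imply Laudenbach–Poénaru's extension theorem in every
universe — the tree's `exists_diffeomorph_comp_incl_eq_of_realise_of_cerf_of_succ`
(`SPC4HandlesThmAPositiveGenus.lean`: normal form, uniqueness of `1`-handlebodies, Nielsen's
theorem, the symmetric models and the genus-zero case are theorems there).
[cite: LaudenbachPoenaruBSMF1972, §2, Lemma 2 and proof of Thm. A (pp. 339–342)] -/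
theorem exists_diffeomorph_comp_incl_eq_holds_of
    (hR : exists_oneHandlebody_realise_laudenbachPoenaruGenerators.{u})
    (hC : cerf_diffeomorph_sphere_three_extends_ball)
    (hA : laudenbachPoenaru_thmA_model_succ) :
    exists_diffeomorph_comp_incl_eq.{u} :=
  exists_diffeomorph_comp_incl_eq_of_realise_of_cerf_of_succ hR hC hA

end Literature.Topology.FourManifolds

end
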